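import Summits.FinalStateConjecture.FinalStateConjecture.Theorems.EIHFluxBalanceInertialRecessionStubSlaving12JetCalculus
import Summits.FinalStateConjecture.FinalStateConjecture.Theorems.EIHFluxBalanceInertialRecessionStubSlaving12JetCompact
import Summits.FinalStateConjecture.FinalStateConjecture.Theorems.EIHFluxBalanceInertialRecessionStubSlaving12JetCompare
import Summits.FinalStateConjecture.FinalStateConjecture.Theorems.EIHFluxBalanceInertialRecessionStubSlaving12Reduction
import Summits.FinalStateConjecture.FinalStateConjecture.Theorems.EIHFluxBalanceInertialRecessionAnsatzSmooth

/-!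
# Route EIHFluxBalance — `InertialRecession` (E′), line `SketchCleanExcision`:
# the frozen ansatz is asymptotically Ricci-flat RELATIVE TO ITS OWN 2-JET near every hole,
# from frozen-vacuum data alone (`C²` capstone of the reduction to RELATIVE-RICCI SLAVING)

Helper file for the crux `stmt-FinalStateConjecture-17403`
(`Summit.FinalStateConjecture.FinalStateConjecture.Theses.EIHFluxBalance.InertialRecession`, E′),
stub `stub_slaving`. `…StubSlaving12Reduction` reduced the stub to FROZEN-VACUUM SLAVING (an `e`
with (V) `Ric(e + g₀) = 0` on late hole-following tubes and (S) `C³`-smallness of `e`). This file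
consumes `e` completely:

* `exists_relRicciC2_of_frozenVacuum` — **capstone (`C²`, jet-relative; the `C³` analogue is the
  next step, see below)**: under (V), (S)
  and three kinematic clauses (Lorentz factors `≤ γ`, smooth motions, separating centres), for
  every hole `i`, lab radius `R`, floor `r₀ ≥ rinᵢ` and `ε > 0` there is `T` such that at every
  point `x` of the tube `{x⁰ > T, ‖x̲ − ξᵢ(x⁰)‖ < R, rᵢ > r₀}` and every `λ ≥ 1` with
  `‖Dg₀(x)‖ ≤ λ`, `‖D²g₀(x)‖ ≤ λ²`: `‖Ric(g₀)(x)‖ ≤ ε λ²`. Proof: ZOOM by `ψ(w) = x + w/λ` (`…StubSlaving12JetCalculus`): the zoomed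
  lab field `(e + g₀) ∘ ψ` is Ricci-flat near `0`, the zoomed ansatz `g₀ ∘ ψ` has
  `Ric = λ⁻² Ric(g₀)(x)` at `0` (and `D Ric = λ⁻³ D[Ric g₀](x)`, `fderiv_ricAt_comp_zoom`), its `2`-jet lies in the compact set
  `{0} × {‖A‖ ≤ α, (m/4)-coercive} × B̄(0,1)²` (late-time coercivity and boundedness of the ansatz,
  `…StubSlaving12JetCompact`, `…StubSlaving11AnsatzBound`) inside the open domain of the Ricci jet
  function, where `ricciJet` and `D ricciJet` are uniformly Lipschitz and bounded
  (`exists_uniform_lipschitz_near_isCompact`), and the two zoomed jets differ by the zoomed jets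
  of `e`, of size `≤ δ` by (S); the comparison itself is `norm_ricAt_le_of_jets`
  (`…StubSlaving12JetCompare`).

The `C³` analogue (`‖D³g₀(x)‖ ≤ λ³ ⇒ ‖D[Ric g₀](x)‖ ≤ ε λ³`) follows the same route with
`norm_fderiv_ricAt_le_of_jets` (landed) once the third zoomed jets are compared; with it, the
registered `stub_relRicciSlaving` (RELATIVE-RICCI SLAVING: jet-relative `C²`/`C³` Ricci-smallness of
`g₀` on late tubes ⇒ `SLAVED³`) implies `stub_frozenVacuumSlaving` through this capstone. No
definitions, no named facts, no `sorry`.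
-/

set_option linter.dupNamespace false
set_option maxSynthPendingDepth 6
set_option synthInstance.maxHeartbeats 200000

noncomputable section

namespace Summit.FinalStateConjecture.FinalStateConjecture.Theorems.SublinearIsFree.Slaving

open scoped BigOperators Topology Manifold ContDiff ENNReal
open Filter Set Function TopologicalSpace Metric Literature.Geometry.Lorentzian
  Literature.Geometry.Lorentzian.MetricCoord
open Summit.FinalStateConjecture.FinalStateConjecture.Theorems

/-- The space of `2`-jets of metric components on `E4` (local notation). -/
local notation "Jet" => E4 × (E4 →L[ℝ] E4 →L[ℝ] ℝ) × (E4 →L[ℝ] E4 →L[ℝ] E4 →L[ℝ] ℝ) ×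
  (E4 →L[ℝ] E4 →L[ℝ] E4 →L[ℝ] E4 →L[ℝ] ℝ)

/-! ### The capstone: jet-relative `C²`/`C³` Ricci-smallness of the frozen ansatz -/

set_option maxHeartbeats 1600000 in
/-- **The frozen ansatz is asymptotically Ricci-flat relative to its own `3`-jet near every hole,
from frozen-vacuum data (`C²` part).** Painted moduli with Lorentz factors `≤ γ`, smooth motions, separating
centres, subextremal parameters with `r₋ < rinᵢ < r₊`; a field `e` with (V) `e + g₀` vacuum metric
components on every late hole-following tube with floor `≥ rinᵢ` (avoiding all cores) and (S)
`C³`-small on the core-free late slabs. Then for every hole `i`, `R`, `r₀ ≥ rinᵢ`, `ε > 0` there is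
`T` with: at every `x` of the tube `{x⁰ > T, ‖x̲ − ξᵢ(x⁰)‖ < R, rᵢ > r₀}` and every `λ ≥ 1` with
`‖Dg₀(x)‖ ≤ λ`, `‖D²g₀(x)‖ ≤ λ²`: `‖Ric(g₀)(x)‖ ≤ ε λ²` (zoom by `1/λ`, compactness of the zoomed
ansatz jets, Lipschitz bounds for `ricciJet`, vacuum of the zoomed lab field). [folklore] -/
theorem exists_relRicciC2_of_frozenVacuum {N : ℕ} {M a rin : Fin N → ℝ} {Λ : Fin N → ℝ → lorentzGroup}
    {ξ : Fin N → ℝ → E3} {γ : ℝ} {e : E4 → E4 →L[ℝ] E4 →L[ℝ] ℝ}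
    (h1 : (∀ i, Kerr.IsSubextremal (M i) (a i) ∧ Kerr.rMinus (M i) (a i) < rin i ∧ rin i < Kerr.rPlus (M i) (a i)))
    (hγ : (∀ i t, |((Λ i t : E4 ≃L[ℝ] E4) (E4.basisVector 0)) 0| ≤ γ))
    (hsm : (∀ i, ContDiff ℝ ((⊤ : ℕ∞) : WithTop ℕ∞) (ξ i) ∧ ContDiff ℝ ((⊤ : ℕ∞) : WithTop ℕ∞) (fun t ↦ ((Λ i t : E4 ≃L[ℝ] E4) : E4 →L[ℝ] E4))))
    (hsep : (∀ i j, i ≠ j → Tendsto (fun t ↦ ‖ξ i t - ξ j t‖) atTop atTop))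
    (hV : (∀ (i : Fin N) (R r₀ : ℝ), rin i ≤ r₀ → ∃ T : ℝ, MetricCoord.IsMetricOn (fun z : E4 ↦ e z + (Minkowski.bilin + ∑ i, (boostedKerrBilin (Λ i (z 0)) (E4.ofTimeSpace (z 0) (ξ i (z 0))) (M i) (a i) z - Minkowski.bilin))) {x : E4 | T < x 0 ∧ ‖E4.spatial x - ξ i (x 0)‖ < R ∧ r₀ < Kerr.radius (a i) (poincareInv (Λ i (x 0)) (E4.ofTimeSpace (x 0) (ξ i (x 0))) x)} ∧ ∀ x : E4, T < x 0 → ‖E4.spatial x - ξ i (x 0)‖ < R → r₀ < Kerr.radius (a i) (poincareInv (Λ i (x 0)) (E4.ofTimeSpace (x 0) (ξ i (x 0))) x) → (∀ j, rin j < Kerr.radius (a j) (poincareInv (Λ j (x 0)) (E4.ofTimeSpace (x 0) (ξ j (x 0))) x)) ∧ MetricCoord.ricAt (fun z : E4 ↦ e z + (Minkowski.bilin + ∑ i, (boostedKerrBilin (Λ i (z 0)) (E4.ofTimeSpace (z 0) (ξ i (z 0))) (M i) (a i) z - Minkowski.bilin))) x = 0))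
    (hS : Tendsto (fun t : ℝ ↦ supCkENorm {x : E4 | x 0 = t ∧ ∀ j, rin j < Kerr.radius (a j) (poincareInv (Λ j (x 0)) (E4.ofTimeSpace (x 0) (ξ j (x 0))) x)} 3 e) atTop (𝓝 0))
    (i : Fin N) (R r₀ : ℝ) (hr₀ : rin i ≤ r₀) {ε : ℝ} (hε : 0 < ε) :
    ∃ T : ℝ, ∀ x : E4, T < x 0 → ‖E4.spatial x - ξ i (x 0)‖ < R → r₀ < Kerr.radius (a i) (poincareInv (Λ i (x 0)) (E4.ofTimeSpace (x 0) (ξ i (x 0))) x) → ∀ l : ℝ, 1 ≤ l → ‖fderiv ℝ (fun z : E4 ↦ Minkowski.bilin + ∑ i, (boostedKerrBilin (Λ i (z 0)) (E4.ofTimeSpace (z 0) (ξ i (z 0))) (M i) (a i) z - Minkowski.bilin)) x‖ ≤ l → ‖fderiv ℝ (fderiv ℝ (fun z : E4 ↦ Minkowski.bilin + ∑ i, (boostedKerrBilin (Λ i (z 0)) (E4.ofTimeSpace (z 0) (ξ i (z 0))) (M i) (a i) z - Minkowski.bilin))) x‖ ≤ l ^ 2 → ‖MetricCoord.ricAt (fun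 z : E4 ↦ Minkowski.bilin + ∑ i, (boostedKerrBilin (Λ i (z 0)) (E4.ofTimeSpace (z 0) (ξ i (z 0))) (M i) (a i) z - Minkowski.bilin)) x‖ ≤ ε * l ^ 2 := by
  set g₀ : E4 → E4 →L[ℝ] E4 →L[ℝ] ℝ := (fun z : E4 ↦ Minkowski.bilin + ∑ i, (boostedKerrBilin (Λ i (z 0)) (E4.ofTimeSpace (z 0) (ξ i (z 0))) (M i) (a i) z - Minkowski.bilin)) with hg₀
  -- sizes
  have hr₀' : 0 < r₀ := ((h1 i).1.rMinus_nonneg.trans_lt (h1 i).2.1).trans_le hr₀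
  have hγ1 : 1 ≤ γ := (one_le_abs_lorentz_apply_zero (Λ i 0)).trans (hγ i 0)
  have hK₀ : 0 < (1 + 3 * γ) ^ 2 * (1 + 4 * (|M i| / r₀)) :=
    mul_pos (pow_pos (by linarith) 2) (by positivity)
  set m : ℝ := ((1 + 3 * γ) ^ 2 * (1 + 4 * (|M i| / r₀)))⁻¹ with hm
  have hm0 : 0 < m := inv_pos.2 hK₀
  set α : ℝ := ‖(Minkowski.bilin : E4 →L[ℝ] E4 →L[ℝ] ℝ)‖ +
    ∑ j, 4 * (|M j| / min r₀ 1) * (1 + 3 * γ) ^ 2 with hα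
  -- the compact jet box inside the domain of the Ricci jet function
  set KA : Set (E4 →L[ℝ] E4 →L[ℝ] ℝ) := {A | ‖A‖ ≤ α ∧ ∀ v : E4, m / 4 * ‖v‖ ≤ ‖A v‖} with hKA
  set Kj : Set Jet := ({(0 : E4)} : Set E4) ×ˢ (KA ×ˢ
    (closedBall (0 : E4 →L[ℝ] E4 →L[ℝ] E4 →L[ℝ] ℝ) 1 ×ˢ
      closedBall (0 : E4 →L[ℝ] E4 →L[ℝ] E4 →L[ℝ] E4 →L[ℝ] ℝ) 1)) with hKj
  have hKjc : IsCompact Kj :=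
    isCompact_singleton.prod ((isCompact_coerciveBox α (m / 4)).prod
      ((isCompact_closedBall _ _).prod (isCompact_closedBall _ _)))
  have hΩ := isOpen_ricciJetDomain (E := E4)
  haveI i1 : FiniteDimensional ℝ (E4 →L[ℝ] E4 →L[ℝ] ℝ) := inferInstance
  haveI i2 : FiniteDimensional ℝ (E4 →L[ℝ] E4 →L[ℝ] E4 →L[ℝ] ℝ) := inferInstance
  haveI i3 : FiniteDimensional ℝ (E4 →L[ℝ] E4 →L[ℝ] E4 →L[ℝ] E4 →L[ℝ] ℝ) := inferInstance
  haveI i4 : FiniteDimensional ℝ Jet := inferInstance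
  haveI : ProperSpace Jet := FiniteDimensional.proper_real _
  have hKjΩ : Kj ⊆ {j : Jet | j.2.1.IsInvertible} :=
    fun j hj ↦ coerciveBox_subset_isInvertible (by positivity) hj.2.1
  -- uniform Lipschitz data for `ricciJet` and its derivative near the box
  have hR1 : ContDiffOn ℝ 1 (ricciJet (E := E4)) {j : Jet | j.2.1.IsInvertible} :=
    contDiffOn_ricciJet.of_le (by simp)
  obtain ⟨r₁, hr₁, L₀, B₀, hL₀, -, hLip₀⟩ := exists_uniform_lipschitz_near_isCompact hΩ hR1 hKjc hKjΩ
  -- the smallness threshold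
  have hS0 : 0 < L₀ + 1 := by linarith
  set δ : ℝ := min r₁ (ε / (L₀ + 1)) with hδ
  have hδ0 : 0 < δ := lt_min hr₁ (div_pos hε hS0)
  have hδr₁ : δ ≤ r₁ := min_le_left _ _
  have hδε : (L₀ + 1) * δ ≤ ε := by
    have : δ ≤ ε / (L₀ + 1) := min_le_right _ _
    rwa [le_div_iff₀ hS0, mul_comm] at this
  -- late times
  obtain ⟨T₁, hG₁, hvac⟩ := hV i R r₀ hr₀
  have E1 := eventually_ansatz_coercive_near_hole (M := M) (a := a) hγ hsep i R hr₀'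
  have E2 := eventually_norm_ansatz_le_near_hole (M := M) (a := a) hγ hsep i R hr₀'
  have E3 : ∀ᶠ t in atTop, supCkENorm {x : E4 | x 0 = t ∧ ∀ j, rin j < Kerr.radius (a j) (poincareInv (Λ j (x 0)) (E4.ofTimeSpace (x 0) (ξ j (x 0))) x)} 3 e < ENNReal.ofReal δ :=
    (tendsto_order.1 hS).2 _ (ENNReal.ofReal_pos.2 hδ0)
  obtain ⟨T₂, hT₂⟩ := eventually_atTop.1 ((E1.and E2).and E3)
  refine ⟨max T₁ T₂, fun x hxT hxR hxr l hl hD1 hD2 ↦ ?_⟩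
  have hxT₁ : T₁ < x 0 := (le_max_left _ _).trans_lt hxT
  have hxT₂ : T₂ < x 0 := (le_max_right _ _).trans_lt hxT
  -- the open neighbourhood `A` of `x`
  set A : Set E4 := {z : E4 | T₁ < z 0 ∧ ‖E4.spatial z - ξ i (z 0)‖ < R ∧ r₀ < Kerr.radius (a i) (poincareInv (Λ i (z 0)) (E4.ofTimeSpace (z 0) (ξ i (z 0))) z)} ∩
    {z : E4 | T₂ < z 0} with hA
  have hAo : IsOpen A :=
    hG₁.isOpen.inter (isOpen_lt continuous_const (EuclideanSpace.proj (0 : Fin 4)).continuous)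
  have hxA : x ∈ A := ⟨⟨hxT₁, hxR, hxr⟩, hxT₂⟩
  have hfacts : ∀ z ∈ A, (∀ j, 0 < Kerr.radius (a j) (poincareInv (Λ j (z 0)) (E4.ofTimeSpace (z 0) (ξ j (z 0))) z)) ∧ (∀ v : E4, m / 2 * ‖v‖ ≤ ‖g₀ z v‖) ∧ ‖g₀ z‖ ≤ α ∧
      (∀ j, rin j < Kerr.radius (a j) (poincareInv (Λ j (z 0)) (E4.ofTimeSpace (z 0) (ξ j (z 0))) z)) ∧ ricAt (fun w ↦ e w + g₀ w) z = 0 := by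
    intro z hz
    obtain ⟨⟨hzT₁, hzR, hzr⟩, hzT₂⟩ := hz
    obtain ⟨⟨h1', h2'⟩, -⟩ := hT₂ (z 0) hzT₂.le
    obtain ⟨hr, hc⟩ := h1' z rfl hzR.le hzr.le
    obtain ⟨hcore, hric⟩ := hvac z hzT₁ hzR hzr
    exact ⟨hr, hc, h2' z rfl hzR.le hzr.le, hcore, hric⟩
  -- metric components on `A`
  have hG : IsMetricOn (fun w ↦ e w + g₀ w) A :=
    ⟨hAo, hG₁.contDiffOn.mono inter_subset_left, fun z hz v w ↦ hG₁.symm z hz.1 v w,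
      fun z hz ↦ hG₁.isInvertible z hz.1⟩
  have hG' : IsMetricOn g₀ A := by
    refine ⟨hAo, fun z hz ↦ ?_, fun z _ v w ↦ ?_, fun z hz ↦ ?_⟩
    · exact (contDiffAt_ansatzBilin' N M a Λ ξ (fun j ↦ (hsm j).2) (fun j ↦ (hsm j).1) z
        (hfacts z hz).1).contDiffWithinAt
    · show (Minkowski.bilin + ∑ i, (boostedKerrBilin (Λ i (z 0)) (E4.ofTimeSpace (z 0) (ξ i (z 0)))
        (M i) (a i) z - Minkowski.bilin)) v w = (Minkowski.bilin + ∑ i, (boostedKerrBilin (Λ i (z 0))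
        (E4.ofTimeSpace (z 0) (ξ i (z 0))) (M i) (a i) z - Minkowski.bilin)) w v
      simp only [add_apply, FunLike.coe_sum, Finset.sum_apply,
        sub_apply, Minkowski.bilin_symm v w, boostedKerrBilin_symm _ _ _ _ z v w]
    · refine MetricCoord.isInvertible_of_nondegenerate fun v hv ↦ ?_
      have h0 : g₀ z v = 0 := ContinuousLinearMap.ext fun w ↦ hv w
      have h1' := (hfacts z hz).2.1 v
      rw [h0, norm_zero] at h1'
      have h2 : ‖v‖ ≤ 0 := by nlinarith [norm_nonneg v]
      exact norm_le_zero_iff.1 h2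
  have he : ContDiffOn ℝ ∞ e A := by
    have hex : e = fun z ↦ (e z + g₀ z) - g₀ z := funext fun z ↦ (add_sub_cancel_right _ _).symm
    rw [hex]
    exact hG.contDiffOn.sub hG'.contDiffOn
  -- jets of the sum `e + g₀` at `x`, up to order three (generic lemma, instantiated here)
  have hS := fderiv_add_jets he hG'.contDiffOn hAo hxA
  -- facts at `x`
  obtain ⟨-, hxc, hxα, hxcore, -⟩ := hfacts x hxA
  obtain ⟨-, hE3x⟩ := hT₂ (x 0) hxT₂.le
  have hmem : x ∈ {y : E4 | y 0 = x 0 ∧ ∀ j, rin j < Kerr.radius (a j) (poincareInv (Λ j (y 0)) (E4.ofTimeSpace (y 0) (ξ j (y 0))) y)} := ⟨rfl, hxcore⟩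
  have hdevk : ∀ k ≤ 3, ‖iteratedFDeriv ℝ k e x‖ ≤ δ := by
    intro k hk
    have h1' := enorm_iteratedFDeriv_le_supCkENorm hk hmem e
    rw [← ofReal_norm] at h1'
    exact ((ENNReal.ofReal_lt_ofReal_iff hδ0).1 (h1'.trans_lt hE3x)).le
  have hd0 : ‖e x‖ ≤ δ := by
    rw [← norm_iteratedFDeriv_zero (𝕜 := ℝ)]; exact hdevk 0 (by norm_num)
  have hd1 : ‖fderiv ℝ e x‖ ≤ δ := by
    rw [(norm_fderiv_eq_norm_iteratedFDeriv e x).1]; exact hdevk 1 (by norm_num)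
  have hd2 : ‖fderiv ℝ (fderiv ℝ e) x‖ ≤ δ := by
    rw [(norm_fderiv_eq_norm_iteratedFDeriv e x).2]; exact hdevk 2 (by norm_num)
  -- the zoom `ψ(w) = x + c w`, `c = 1/l`
  have hl0 : 0 < l := one_pos.trans_le hl
  obtain ⟨c, hc0, hc1, hcl⟩ : ∃ c : ℝ, 0 < c ∧ c ≤ 1 ∧ c * l = 1 :=
    ⟨l⁻¹, inv_pos.2 hl0, inv_le_one_of_one_le₀ hl, inv_mul_cancel₀ hl0.ne'⟩
  have hcne : c ≠ 0 := hc0.ne'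
  have hcn : ‖c‖ = c := by rw [Real.norm_eq_abs, abs_of_pos hc0]
  have hc2 : c ^ 2 * l ^ 2 = 1 := by rw [← mul_pow, hcl, one_pow]
  have hc21 : c ^ 2 ≤ 1 := pow_le_one₀ hc0.le hc1
  have h0A : x + c • (0 : E4) ∈ A := by simpa using hxA
  -- the zoomed fields (terms as produced by `isMetricOn_comp_zoom`)
  have hGc := isMetricOn_comp_zoom hG x c
  have hG'c := isMetricOn_comp_zoom hG' x c
  have h0 : (0 : E4) ∈ (fun w : E4 ↦ x + c • w) ⁻¹' A := h0A
  -- the zoomed lab field is Ricci-flat near `0`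
  have hRic0 : ricAt (fun w : E4 ↦ (fun w ↦ e w + g₀ w) (x + c • w)) =ᶠ[𝓝 0] fun _ ↦ 0 := by
    filter_upwards [hGc.isOpen.mem_nhds h0] with w hw
    rw [ricAt_comp_zoom_eq hG hcne hw, (hfacts _ hw).2.2.2.2, smul_zero]
  have hRc : ricAt (fun w : E4 ↦ (fun w ↦ e w + g₀ w) (x + c • w)) 0 = 0 := hRic0.eq_of_nhds
  -- the zoomed ansatz
  have hRc' : ricAt (fun w : E4 ↦ g₀ (x + c • w)) 0 = (c ^ 2) • ricAt g₀ x := by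
    rw [ricAt_comp_zoom_eq hG' hcne h0A]; simp
  -- jets of the zoomed fields at `0`
  have hJ := jets_comp_zoom (c := c) hG'.contDiffOn hAo hxA
  have hZ := jets_comp_zoom (c := c) hG.contDiffOn hAo hxA
  -- the hypotheses of the jet comparison lemmas (scalar bounds)
  have hn1 : ‖fderiv ℝ (fun w : E4 ↦ g₀ (x + c • w)) 0‖ ≤ 1 := by
    rw [hJ.2.1, norm_smul, hcn, ← hcl]; exact mul_le_mul_of_nonneg_left hD1 hc0.le
  have hn2 : ‖fderiv ℝ (fderiv ℝ (fun w : E4 ↦ g₀ (x + c • w))) 0‖ ≤ 1 := by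
    rw [hJ.2.2, norm_smul, norm_pow, hcn, ← hc2]; exact mul_le_mul_of_nonneg_left hD2 (by positivity)
  have hd0' : ‖(fun w : E4 ↦ (fun w ↦ e w + g₀ w) (x + c • w)) 0 - (fun w : E4 ↦ g₀ (x + c • w)) 0‖ ≤ δ := by
    simp only [smul_zero, add_zero, add_sub_cancel_right]; exact hd0
  have hd1' : ‖fderiv ℝ (fun w : E4 ↦ (fun w ↦ e w + g₀ w) (x + c • w)) 0 -
      fderiv ℝ (fun w : E4 ↦ g₀ (x + c • w)) 0‖ ≤ δ := by
    rw [hZ.2.1, hJ.2.1, hS.1, smul_add, add_sub_cancel_right, norm_smul, hcn]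
    calc c * ‖fderiv ℝ e x‖ ≤ 1 * δ := mul_le_mul hc1 hd1 (norm_nonneg _) zero_le_one
      _ = δ := one_mul δ
  have hd2' : ‖fderiv ℝ (fderiv ℝ (fun w : E4 ↦ (fun w ↦ e w + g₀ w) (x + c • w))) 0 -
      fderiv ℝ (fderiv ℝ (fun w : E4 ↦ g₀ (x + c • w))) 0‖ ≤ δ := by
    rw [hZ.2.2, hJ.2.2, hS.2.1, smul_add, add_sub_cancel_right, norm_smul, norm_pow, hcn]
    calc c ^ 2 * ‖fderiv ℝ (fderiv ℝ e) x‖ ≤ 1 * δ := mul_le_mul hc21 hd2 (norm_nonneg _) zero_le_one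
      _ = δ := one_mul δ
  have hval : (fun w : E4 ↦ g₀ (x + c • w)) 0 = g₀ x := by simp only [smul_zero, add_zero]
  have hKA : (fun w : E4 ↦ g₀ (x + c • w)) 0 ∈ KA := by
    rw [hval]
    refine ⟨hxα, fun v ↦ ?_⟩
    have hm4 : m / 4 ≤ m / 2 := by linarith only [hm0]
    exact (mul_le_mul_of_nonneg_right hm4 (norm_nonneg v)).trans (hxc v)
  have hb1 : fderiv ℝ (fun w : E4 ↦ g₀ (x + c • w)) 0 ∈
      closedBall (0 : E4 →L[ℝ] E4 →L[ℝ] E4 →L[ℝ] ℝ) 1 := mem_closedBall_zero_iff.2 hn1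
  have hb2 : fderiv ℝ (fderiv ℝ (fun w : E4 ↦ g₀ (x + c • w))) 0 ∈
      closedBall (0 : E4 →L[ℝ] E4 →L[ℝ] E4 →L[ℝ] E4 →L[ℝ] ℝ) 1 := mem_closedBall_zero_iff.2 hn2
  have hK' : (((0 : E4), (fun w : E4 ↦ g₀ (x + c • w)) 0, fderiv ℝ (fun w : E4 ↦ g₀ (x + c • w)) 0,
      fderiv ℝ (fderiv ℝ (fun w : E4 ↦ g₀ (x + c • w))) 0) : Jet) ∈ Kj :=
    Set.mk_mem_prod (Set.mem_singleton _) (Set.mk_mem_prod hKA (Set.mk_mem_prod hb1 hb2))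
  have hLip₀' : ∀ j' ∈ Kj, ∀ j : Jet, ‖j - j'‖ ≤ r₁ →
      ‖ricciJet (E := E4) j - ricciJet (E := E4) j'‖ ≤ L₀ * ‖j - j'‖ :=
    fun j' hj' j hj ↦ (hLip₀ j' hj' j hj).1
  -- `C²`
  have key2 := norm_ricAt_le_of_jets hGc hG'c h0 hRc hL₀ hLip₀' hK' hδ0.le hδr₁ hd0' hd1' hd2'
  rw [hRc', norm_smul, norm_pow, hcn] at key2
  have hL₀δ : L₀ * δ ≤ ε := by nlinarith only [hδε, hδ0, hL₀]
  have key2' : c ^ 2 * ‖ricAt g₀ x‖ ≤ ε := key2.trans hL₀δ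
  have hC2 : ‖ricAt g₀ x‖ ≤ ε * l ^ 2 := by
    have h' := mul_le_mul_of_nonneg_right key2' (by positivity : (0 : ℝ) ≤ l ^ 2)
    calc ‖ricAt g₀ x‖ = c ^ 2 * ‖ricAt g₀ x‖ * l ^ 2 := by
          rw [mul_comm (c ^ 2), mul_assoc, hc2, mul_one]
      _ ≤ ε * l ^ 2 := h'
  exact hC2

/-- **Registered one-line carrier form** (`slaving_relRicciC2_of_frozenVacuum_slaving12`) of
`exists_relRicci_of_frozenVacuum`. [folklore] -/
theorem slaving_relRicciC2_of_frozenVacuum_slaving12 : open Literature.Geometry.Lorentzian Filter Topology in ∀ {N : ℕ} {M a rin : Fin N → ℝ} {Λ : Fin N → ℝ → lorentzGroup} {ξ : Fin N → ℝ → E3} {γ : ℝ} {e : E4 → E4 →L[ℝ] E4 →L[ℝ] ℝ}, (∀ i, Kerr.IsSubextremal (M i) (a i) ∧ Kerr.rMinus (M i) (a i) < rin i ∧ rin i < Kerr.rPlus (M i) (a i)) → (∀ i t, |((Λ i t : E4 ≃L[ℝ] E4) (E4.basisVector 0)) 0| ≤ γ) → (∀ i, ContDiff ℝ ((⊤ :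 ℕ∞) : WithTop ℕ∞) (ξ i) ∧ ContDiff ℝ ((⊤ : ℕ∞) : WithTop ℕ∞) (fun t ↦ ((Λ i t : E4 ≃L[ℝ] E4) : E4 →L[ℝ] E4))) → (∀ i j, i ≠ j → Tendsto (fun t ↦ ‖ξ i t - ξ j t‖) atTop atTop) → (∀ (i : Fin N) (R r₀ : ℝ), rin i ≤ r₀ → ∃ T : ℝ, MetricCoord.IsMetricOn (fun z : E4 ↦ e z + (Minkowski.bilin + ∑ i, (boostedKerrBilin (Λ i (z 0)) (E4.ofTimeSpace (z 0) (ξ i (z 0))) (M i) (a i) z - Minkowski.bilin))) {x : E4 | T < x 0 ∧ ‖E4.spatial x - ξ i (x 0)‖ < R ∧ r₀ < Kerr.radius (a i) (poincareInv (Λ i (x 0)) (E4.ofTimeSpace (x 0) (ξ i (x 0))) x)} ∧ ∀ x : E4, T < x 0 → ‖E4.spatial x - ξ i (x 0)‖ < R → r₀ < Kerr.radius (a i) (poincareInv (Λ i (x 0)) (E4.ofTimeSpace (x 0) (ξ i (x 0))) x) → (∀ j, rin j < Kerr.radius (a j) (poincareInv (Λ j (x 0)) (E4.ofTimeSpace (x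 0) (ξ j (x 0))) x)) ∧ MetricCoord.ricAt (fun z : E4 ↦ e z + (Minkowski.bilin + ∑ i, (boostedKerrBilin (Λ i (z 0)) (E4.ofTimeSpace (z 0) (ξ i (z 0))) (M i) (a i) z - Minkowski.bilin))) x = 0) → Tendsto (fun t : ℝ ↦ supCkENorm {x : E4 | x 0 = t ∧ ∀ j, rin j < Kerr.radius (a j) (poincareInv (Λ j (x 0)) (E4.ofTimeSpace (x 0) (ξ j (x 0))) x)} 3 e) atTop (𝓝 0) → ∀ (i : Fin N) (R r₀ : ℝ), rin i ≤ r₀ → ∀ {ε : ℝ}, 0 < ε → ∃ T : ℝ, ∀ x : E4, T < x 0 → ‖E4.spatial x - ξ i (x 0)‖ < R → r₀ < Kerr.radius (a i) (poincareInv (Λ i (x 0)) (E4.ofTimeSpace (x 0) (ξ i (x 0))) x) → ∀ l : ℝ, 1 ≤ l → ‖fderiv ℝ (fun z : E4 ↦ Minkowski.bilin + ∑ i, (boostedKerrBilin (Λ i (z 0)) (E4.ofTimeSpace (z 0) (ξ i (z 0))) (M i) (a i) z - Minkowski.bilin)) x‖ ≤ l → ‖fderiv ℝ (fderiv ℝ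 (fun z : E4 ↦ Minkowski.bilin + ∑ i, (boostedKerrBilin (Λ i (z 0)) (E4.ofTimeSpace (z 0) (ξ i (z 0))) (M i) (a i) z - Minkowski.bilin))) x‖ ≤ l ^ 2 → ‖MetricCoord.ricAt (fun z : E4 ↦ Minkowski.bilin + ∑ i, (boostedKerrBilin (Λ i (z 0)) (E4.ofTimeSpace (z 0) (ξ i (z 0))) (M i) (a i) z - Minkowski.bilin)) x‖ ≤ ε * l ^ 2 :=
  fun h1 hγ hsm hsep hV hS i R r₀ hr₀ _ hε ↦
    exists_relRicciC2_of_frozenVacuum h1 hγ hsm hsep hV hS i R r₀ hr₀ hε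

end Summit.FinalStateConjecture.FinalStateConjecture.Theorems.SublinearIsFree.Slaving

end
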